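import Summits.QuantumFields.YangMills.Theorems.BalabanUVNodesN22KnitDiscrete

/-!
# BalabanUVNodes ∕ N22 knit, THE SECOND-ORDER STEP RECURSION — the regularity clause (R₂) of `BalabanUVNodesN22KnitDiscrete` from a
# ONE-STEP second-difference inequality of the renormalization recursion (the chain rule through [Balaban1987RG1] (2.13)'s curly
# bracket, as a hypothesis SHAPE), with constants GROWING geometrically at any rate `ν > max(ω + c, μ₁²)`; hence node N22 = NE9 ∧
# FadingMemory BY NAME whenever the tower rate `θ` has `θν < 1` — the E-side smallness «ω + c < 1» (clause N2) of the END of record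
# relaxed to «ω + c < θ^{−1∕2}» on ROAD 2 (Track A, DAG node N22; cluster K4 «SpineRates»; seat `pub-ymgap-dag-n22-a`)

HONEST FRAMING.  Count-neutral kernel bookkeeping over hypothesis shapes on the ABSTRACT carriers `T4OutputRate.Carriers`; NOT a node
discharge; NE5 ∕ NE9 NOT IN PRINT, NOT PROVED; instance on Bałaban's `E^{(j)}` 0∕1 (wall W1 = the one-step transformation as a Lean object,
unchanged); one finite four-torus programme at fixed ε; nothing continuum ∕ ℝ⁴ ∕ OS ∕ mass-gap ∕ Clay.  0 `sorry`, 0 `def`, standard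
axioms.  `--supports` item `SpineGivenEndpoint` (route «BalabanUVNodes», cluster K4).

THE POINT.  ROAD 1 to N22 (the END of record, `Spine/NE9/LeafIndex.rootShape_of_leaves`; structural core
`T4HistoryLipschitzRecursion.ne9_of_stepLipschitz`) derives NE9's moduli from a FIRST-order one-step inequality `StepLipschitz E W κ lam a`
by a renewal induction; its moduli grow like `(ω + c)^{age}` and FADE iff `ω + c < 1` (clause N2; `sticky_not_fadingMemory`: no fading
without it ON THAT ROAD).  ROAD 2 (`BalabanUVNodesN22Knit{,Discrete}`) gets the fading from the tower η-rate `θ` instead and needs only a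
REGULARITY clause whose constants may grow like `μ^{age}` with `θμ < 1`.  THIS FILE supplies that clause from the recursion, at second order:
* §1 `geomConv_le`, `renewal2_sum_le` — the arithmetic of the second-order renewal: with channel weights `a k j ≤ c·ω^{k−j}` (linear channel)
  and `b k j ≤ c_b·ω^{k−j}` (quadratic ∕ variance channel), first-order profile `ℓ₁·μ₁^{age−1}·d` and candidate second-order profile
  `L₂·ν^{age−1}·d²`, the profile reproduces itself one scale up as soon as `ω + c < ν`, `μ₁² ≤ ν` and `c_b ℓ₁² ≤ L₂ (ν − ω − c)`.
* §2 `secondDiff_of_stepSecondDiff` — STRONG INDUCTION ON THE CREATION STEP (the second-order twin of `ne9_of_stepLipschitz`): (P) prefix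
  dependence + (L1) first-order coordinatewise moduli `ℓ₁·μ₁^{age−1}` + (S2-last) second differences in the LAST coupling `≤ lam₂ k·d²·e^{−κd}`
  + (S2-old) THE SECOND-ORDER STEP INEQUALITY (old couplings: new second difference ≤ `e^{−κd}·Σ_{j≤k}(a k j·D₂ j + b k j·(D₁ j)²)` given the
  old terms' first ∕ second difference profiles `D₁`, `D₂`) ⟹ the clause (R₂): second differences of every young-coupling section on `]0, γ]`
  `≤ L₂·ν^{scale X − 1 − i}·e^{−κd(X)}·d²`, `L₂ = max ℓ₂ (c_b ℓ₁²∕(ν − ω − c))`, for EVERY `ν > ω + c` with `ν ≥ μ₁²` — NO smallness of `ω + c`.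
* §3 `ne9_and_fadingMemory_of_osc_stepSecondDiff` — with (O) oscillation fading at rate `θ` (= tower-NE5) and a step ratio `ρ ∈ ]0, 1]`,
  rate `τ > 0` with `θ ≤ τρ`, `νρ ≤ τ`: **`NE9 E (Window γ) κ Λ₁ ∧ FadingMemory C₉ τ Λ₁`**, `C₉ = (4C₀∕γ + L₂γ∕2)∕τ` (`N22KnitDiscrete`'s
  headline); along ne9's tower of carriers combine §2 per level with `N22KnitDiscrete.towerNE9_fadingMemory_of_towerNE5_secondDiff`
  (node N18 BY NAME supplies (O)).  READING: fading (`τ < 1`) is available iff `θν < 1`; with ROAD 1's first-order growth `μ₁ = ω + c ≥ 1` one may take `ν` just above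
  `(ω + c)²`, so ROAD 2 closes N22 whenever `ω + c < θ^{−1∕2}` — a window STRICTLY LARGER than N2's `ω + c < 1` (θ < 1), bought with the
  tower rate (node N18 at all run lengths) and second-order (instead of first-order) step regularity.  Both remain W1 outputs.  HONESTY ON
  THE GAIN: it is real exactly when the tower η-rate `θ` (UV insensitivity at fixed arguments, King's `L^{−γk}` type) is SMALLER than
  `(ω + c)^{−2}` (history-transfer growth of the recursion); in `Spine/NE9/TowerRateRelocation`'s Markov caricature the two scalars coincide
  (`towerRate_iff_lt_one`) and the gain there is nil — the two roads then ask the same smallness in different currencies.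

References (TYPES only): [Balaban1987RG1] = T. Bałaban, Commun. Math. Phys. **109** (1987) 249–301 — (0.23) p. 256, (1.18) and the C^∞
clause p. 263, (2.12)–(2.14) p. 268, p. 298.
-/

noncomputable section

namespace Summit.QuantumFields.YangMills.BalabanUVNodes.N22KnitRecursion

open Finset
open scoped BigOperators

/-! ## §1 The geometric convolution and the second-order renewal arithmetic -/

/-- The GEOMETRIC CONVOLUTION along the steps: `S k = Σ_{j=i+1}^{k} ω^{k−j}·ν^{j−1−i} ≤ ν^{k−i}∕(ν − ω)` for `0 ≤ ω < ν` (`k ≥ i`;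
induction on `k`: `S (k+1) = ω·S k + ν^{k−i}`). [folklore] -/
theorem geomConv_le {ω ν : ℝ} (hω : 0 ≤ ω) (hων : ω < ν) (i : ℕ) :
    ∀ k, i ≤ k → ∑ j ∈ Ico (i + 1) (k + 1), ω ^ (k - j) * ν ^ (j - 1 - i) ≤ ν ^ (k - i) / (ν - ω) := by
  have hν : 0 < ν := hω.trans_lt hων
  have hνω : 0 < ν - ω := by linarith
  intro k hk
  induction k, hk using Nat.le_induction with
  | base =>
    rw [Ico_self, sum_empty, Nat.sub_self, pow_zero]
    positivity
  | succ k hk ih =>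
    rw [sum_Ico_succ_top (by omega : i + 1 ≤ k + 1), Nat.sub_self, pow_zero, one_mul,
      show k + 1 - 1 - i = k - i by omega]
    have hsplit : ∑ j ∈ Ico (i + 1) (k + 1), ω ^ (k + 1 - j) * ν ^ (j - 1 - i)
        = ω * ∑ j ∈ Ico (i + 1) (k + 1), ω ^ (k - j) * ν ^ (j - 1 - i) := by
      rw [mul_sum]
      refine sum_congr rfl fun j hj => ?_
      rw [mem_Ico] at hj
      rw [show k + 1 - j = (k - j) + 1 by omega, pow_succ]
      ring
    rw [hsplit]
    have hk' : ν ^ (k + 1 - i) = ν * ν ^ (k - i) := by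
      rw [show k + 1 - i = (k - i) + 1 by omega, pow_succ, mul_comm]
    rw [hk']
    have hpow : 0 ≤ ν ^ (k - i) := pow_nonneg hν.le _
    calc ω * ∑ j ∈ Ico (i + 1) (k + 1), ω ^ (k - j) * ν ^ (j - 1 - i) + ν ^ (k - i)
        ≤ ω * (ν ^ (k - i) / (ν - ω)) + ν ^ (k - i) := by
          have := mul_le_mul_of_nonneg_left ih hω
          linarith
      _ = ν * ν ^ (k - i) / (ν - ω) := by field_simp; ring

/-- **THE SECOND-ORDER RENEWAL STEP (arithmetic).**  Channel weights `0 ≤ a k j ≤ c·ω^{k−j}`, `0 ≤ b k j ≤ c_b·ω^{k−j}` (`j ≤ k`), a first-order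
profile `D₁ j = ℓ₁·μ₁^{j−1−i}·d` and the candidate second-order profile `D₂ j = L₂·ν^{j−1−i}·d²` on the steps `j > i` (both `0` for
`j ≤ i`), with `0 ≤ ω`, `ω + c < ν`, `μ₁² ≤ ν`, `0 ≤ L₂` and `c_b·ℓ₁² ≤ L₂·(ν − ω − c)`: then
`Σ_{j ≤ k} (a k j·D₂ j + b k j·(D₁ j)²) ≤ L₂·ν^{k−i}·d²` (`i < k`) — the profile `D₂` reproduces itself one scale up. [folklore] -/
theorem renewal2_sum_le {a b : ℕ → ℕ → ℝ} {c cb ω ν ℓ₁ μ₁ L₂ d : ℝ} {i k : ℕ} (hik : i < k)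
    (ha : ∀ k j, j ≤ k → 0 ≤ a k j ∧ a k j ≤ c * ω ^ (k - j)) (hb : ∀ k j, j ≤ k → 0 ≤ b k j ∧ b k j ≤ cb * ω ^ (k - j))
    (hc : 0 ≤ c) (hcb : 0 ≤ cb) (hω : 0 ≤ ω) (hν : ω + c < ν) (hμν : μ₁ ^ 2 ≤ ν) (hL₂ : 0 ≤ L₂)
    (hL₂' : cb * ℓ₁ ^ 2 ≤ L₂ * (ν - ω - c)) :
    ∑ j ∈ range (k + 1),
        (a k j * (if i < j then L₂ * ν ^ (j - 1 - i) * d ^ 2 else 0)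
          + b k j * (if i < j then ℓ₁ * μ₁ ^ (j - 1 - i) * d else 0) ^ 2)
      ≤ L₂ * ν ^ (k - i) * d ^ 2 := by
  have hνpos : 0 < ν := by nlinarith [sq_nonneg μ₁]
  have hων : ω < ν := by linarith
  have hd2 : 0 ≤ d ^ 2 := sq_nonneg d
  -- termwise: vanishing for `j ≤ i`, geometric for `j > i`
  have hterm : ∀ j ∈ range (k + 1),
      a k j * (if i < j then L₂ * ν ^ (j - 1 - i) * d ^ 2 else 0)
          + b k j * (if i < j then ℓ₁ * μ₁ ^ (j - 1 - i) * d else 0) ^ 2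
        ≤ if i < j then (c * L₂ + cb * ℓ₁ ^ 2) * d ^ 2 * (ω ^ (k - j) * ν ^ (j - 1 - i)) else 0 := by
    intro j hj
    rw [mem_range] at hj
    have hjk : j ≤ k := by omega
    obtain ⟨ha0, ha1⟩ := ha k j hjk
    obtain ⟨hb0, hb1⟩ := hb k j hjk
    by_cases hij : i < j
    · rw [if_pos hij, if_pos hij, if_pos hij]
      have hνp : 0 ≤ ν ^ (j - 1 - i) := pow_nonneg hνpos.le _
      have hμp : μ₁ ^ (2 * (j - 1 - i)) ≤ ν ^ (j - 1 - i) := by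
        rw [pow_mul]; exact pow_le_pow_left₀ (sq_nonneg μ₁) hμν _
      have h1 : a k j * (L₂ * ν ^ (j - 1 - i) * d ^ 2) ≤ c * ω ^ (k - j) * (L₂ * ν ^ (j - 1 - i) * d ^ 2) :=
        mul_le_mul_of_nonneg_right ha1 (by positivity)
      have h2 : b k j * (ℓ₁ * μ₁ ^ (j - 1 - i) * d) ^ 2 ≤ cb * ω ^ (k - j) * (ℓ₁ ^ 2 * ν ^ (j - 1 - i) * d ^ 2) := by
        have e : (ℓ₁ * μ₁ ^ (j - 1 - i) * d) ^ 2 = ℓ₁ ^ 2 * μ₁ ^ (2 * (j - 1 - i)) * d ^ 2 := by ring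
        rw [e]
        calc b k j * (ℓ₁ ^ 2 * μ₁ ^ (2 * (j - 1 - i)) * d ^ 2)
            ≤ b k j * (ℓ₁ ^ 2 * ν ^ (j - 1 - i) * d ^ 2) :=
              mul_le_mul_of_nonneg_left (mul_le_mul_of_nonneg_right
                (mul_le_mul_of_nonneg_left hμp (sq_nonneg ℓ₁)) hd2) hb0
          _ ≤ cb * ω ^ (k - j) * (ℓ₁ ^ 2 * ν ^ (j - 1 - i) * d ^ 2) :=
              mul_le_mul_of_nonneg_right hb1 (by positivity)
      calc _ ≤ c * ω ^ (k - j) * (L₂ * ν ^ (j - 1 - i) * d ^ 2) + cb * ω ^ (k - j) * (ℓ₁ ^ 2 * ν ^ (j - 1 - i) * d ^ 2) :=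
            add_le_add h1 h2
        _ = (c * L₂ + cb * ℓ₁ ^ 2) * d ^ 2 * (ω ^ (k - j) * ν ^ (j - 1 - i)) := by ring
    · rw [if_neg hij, if_neg hij, if_neg hij]
      simp
  refine (sum_le_sum hterm).trans ?_
  rw [← sum_filter, show (range (k + 1)).filter (fun j => i < j) = Ico (i + 1) (k + 1) by
    ext j; simp only [mem_filter, mem_range, mem_Ico]; omega, ← mul_sum]
  have hS := geomConv_le hω hων i k hik.le
  have hνωc : 0 < ν - ω - c := by linarith
  have hνω : 0 < ν - ω := by linarith
  calc (c * L₂ + cb * ℓ₁ ^ 2) * d ^ 2 * ∑ j ∈ Ico (i + 1) (k + 1), ω ^ (k - j) * ν ^ (j - 1 - i)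
      ≤ (c * L₂ + cb * ℓ₁ ^ 2) * d ^ 2 * (ν ^ (k - i) / (ν - ω)) :=
        mul_le_mul_of_nonneg_left hS (by positivity)
    _ ≤ L₂ * ν ^ (k - i) * d ^ 2 := by
        -- `(c L₂ + c_b ℓ₁²)/(ν − ω) ≤ L₂`
        have hkey : c * L₂ + cb * ℓ₁ ^ 2 ≤ L₂ * (ν - ω) := by nlinarith
        have hpow : 0 ≤ ν ^ (k - i) := pow_nonneg hνpos.le _
        rw [mul_div_assoc', div_le_iff₀ hνω, mul_comm (c * L₂ + cb * ℓ₁ ^ 2)]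
        have := mul_le_mul_of_nonneg_left hkey (mul_nonneg hd2 hpow)
        nlinarith [this]

/-! ## §2 The second-order step recursion ⇒ the vertex-free regularity clause (R₂) with geometric growth -/

section Abstract

open Literature.MathematicalPhysics.QuantumFieldTheory.Balaban1983to89
open Literature.MathematicalPhysics.QuantumFieldTheory.Balaban1983to89.T4OutputRate

variable {C : Carriers} {Bg : Type} {E : Functional C Bg}

/-- **(R₂) FROM THE SECOND-ORDER STEP INEQUALITY, BY STRONG INDUCTION ON THE CREATION STEP.**  Hypotheses, all binders over the
ABSTRACT carriers (nothing of Bałaban's step modelled): (P) prefix dependence; (L1) coordinatewise FIRST-order moduli with geometric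
growth `ℓ₁·μ₁^{age−1}` (for the recursion of `T4HistoryLipschitzRecursion`: `μ₁ = ω + c`, by `ne9_and_fadingMemory_of_geometricStep` read
without its smallness clause + pv10's `coordLipschitzOn_of_ne9`); (S2-last) the new term's SECOND DIFFERENCES in its OWN (last) coupling are
`≤ lam₂ k·d²·e^{−κd(X)}` ([Balaban1987RG1] p. 263's C^∞ clause at second order — its TYPE); (S2-old) the SECOND-ORDER STEP INEQUALITY: if
along an arithmetic triple of histories in an OLDER coupling `g_i` (`i < k`) the old terms (scales `≤ k`) have first differences
`≤ D₁(scale)·e^{−κd}` and second differences `≤ D₂(scale)·e^{−κd}`, then the new term (scale `k + 1`) has second difference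
`≤ e^{−κd(X)}·Σ_{j≤k} (a k j·D₂ j + b k j·(D₁ j)²)` — the shape of the chain rule through [Balaban1987RG1] (2.13)'s curly bracket
(`log ∫ χ e^{F}`: a linear channel `a` for second differences of the old terms, the tilted-VARIANCE channel `b` for squares of first
differences), NOT PRINTED; channel weights `0 ≤ a k j ≤ c·ω^{k−j}`, `0 ≤ b k j ≤ c_b·ω^{k−j}`, `lam₂ k ≤ ℓ₂`.  CONCLUSION: for every `ν` with
`ω + c < ν`, `μ₁² ≤ ν`: the second differences of every young-coupling section on `]0, γ]` are
`≤ L₂·ν^{scale X − 1 − i}·e^{−κd(X)}·d²`, `L₂ = max ℓ₂ (c_b ℓ₁²∕(ν − ω − c))` — the clause (R₂) of `BalabanUVNodesN22KnitDiscrete` with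
growth `ν`.  No smallness of `ω + c` is needed for (R₂) itself. [folklore] -/
theorem secondDiff_of_stepSecondDiff {γ κ ℓ₁ μ₁ ℓ₂ c cb ω ν : ℝ} {a b : ℕ → ℕ → ℝ} {lam₂ : ℕ → ℝ}
    (hP : PrefixDependenceOn E (Window γ))
    (hL1 : ∀ g ∈ Window γ, ∀ (U : Bg) (X : C.Dom) (i : ℕ), i < C.scale X → ∀ s ∈ Set.Ioc (0 : ℝ) γ, ∀ s' ∈ Set.Ioc (0 : ℝ) γ,
      |E (Function.update g i s) U X - E (Function.update g i s') U X| ≤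
        Real.exp (-(κ * C.d X)) * (ℓ₁ * μ₁ ^ (C.scale X - 1 - i) * |s - s'|))
    (hS2last : ∀ g ∈ Window γ, ∀ (k : ℕ) (t d : ℝ), 0 < d → t - d ∈ Set.Ioc (0 : ℝ) γ → t + d ∈ Set.Ioc (0 : ℝ) γ →
      ∀ (U : Bg) (X : C.Dom), C.scale X = k + 1 →
        |E (Function.update g k (t + d)) U X - 2 * E (Function.update g k t) U X + E (Function.update g k (t - d)) U X| ≤
          Real.exp (-(κ * C.d X)) * (lam₂ k * d ^ 2))
    (hS2old : ∀ g ∈ Window γ, ∀ (i : ℕ) (t d : ℝ), 0 < d → t - d ∈ Set.Ioc (0 : ℝ) γ → t + d ∈ Set.Ioc (0 : ℝ) γ →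
      ∀ (D₁ D₂ : ℕ → ℝ) (k : ℕ), i < k →
        (∀ (U' : Bg) (X' : C.Dom), C.scale X' ≤ k →
          |E (Function.update g i (t + d)) U' X' - E (Function.update g i t) U' X'| ≤ Real.exp (-(κ * C.d X')) * D₁ (C.scale X') ∧
          |E (Function.update g i t) U' X' - E (Function.update g i (t - d)) U' X'| ≤ Real.exp (-(κ * C.d X')) * D₁ (C.scale X') ∧
          |E (Function.update g i (t + d)) U' X' - 2 * E (Function.update g i t) U' X' + E (Function.update g i (t - d)) U' X'| ≤
            Real.exp (-(κ * C.d X')) * D₂ (C.scale X')) →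
        ∀ (U : Bg) (X : C.Dom), C.scale X = k + 1 →
          |E (Function.update g i (t + d)) U X - 2 * E (Function.update g i t) U X + E (Function.update g i (t - d)) U X| ≤
            Real.exp (-(κ * C.d X)) * ∑ j ∈ range (k + 1), (a k j * D₂ j + b k j * D₁ j ^ 2))
    (ha : ∀ k j, j ≤ k → 0 ≤ a k j ∧ a k j ≤ c * ω ^ (k - j)) (hb : ∀ k j, j ≤ k → 0 ≤ b k j ∧ b k j ≤ cb * ω ^ (k - j))
    (hlam₂ : ∀ k, lam₂ k ≤ ℓ₂) (hℓ₂ : 0 ≤ ℓ₂) (hc : 0 ≤ c) (hcb : 0 ≤ cb) (hω : 0 ≤ ω) (hν : ω + c < ν) (hμν : μ₁ ^ 2 ≤ ν) :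
    ∀ g ∈ Window γ, ∀ (U : Bg) (X : C.Dom) (i : ℕ), i < C.scale X → ∀ t d : ℝ, 0 < d →
      t - d ∈ Set.Ioc (0 : ℝ) γ → t + d ∈ Set.Ioc (0 : ℝ) γ →
        |E (Function.update g i (t + d)) U X - 2 * E (Function.update g i t) U X + E (Function.update g i (t - d)) U X| ≤
          max ℓ₂ (cb * ℓ₁ ^ 2 / (ν - ω - c)) * ν ^ (C.scale X - 1 - i) * Real.exp (-(κ * C.d X)) * d ^ 2 := by
  set L₂ := max ℓ₂ (cb * ℓ₁ ^ 2 / (ν - ω - c)) with hL₂def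
  have hνωc : 0 < ν - ω - c := by linarith
  have hνpos : 0 < ν := by nlinarith [sq_nonneg μ₁]
  have hL₂0 : 0 ≤ L₂ := hℓ₂.trans (le_max_left _ _)
  have hL₂' : cb * ℓ₁ ^ 2 ≤ L₂ * (ν - ω - c) := by
    have := le_max_right ℓ₂ (cb * ℓ₁ ^ 2 / (ν - ω - c))
    rw [div_le_iff₀ hνωc] at this
    exact this
  -- strong induction on the creation step
  suffices H : ∀ n, ∀ g ∈ Window γ, ∀ (U : Bg) (X : C.Dom) (i : ℕ), C.scale X ≤ n → i < C.scale X → ∀ t d : ℝ, 0 < d →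
      t - d ∈ Set.Ioc (0 : ℝ) γ → t + d ∈ Set.Ioc (0 : ℝ) γ →
        |E (Function.update g i (t + d)) U X - 2 * E (Function.update g i t) U X + E (Function.update g i (t - d)) U X| ≤
          L₂ * ν ^ (C.scale X - 1 - i) * Real.exp (-(κ * C.d X)) * d ^ 2 from
    fun g hg U X i hi t d hd h1 h2 => H _ g hg U X i le_rfl hi t d hd h1 h2
  intro n
  induction n with
  | zero => intro g hg U X i hX hi; omega
  | succ n ih =>
    intro g hg U X i hX hi t d hd htm htp
    rcases Nat.lt_or_ge (C.scale X) (n + 1) with hlt | hge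
    · exact ih g hg U X i (Nat.lt_succ_iff.mp hlt) hi t d hd htm htp
    have hk : C.scale X = n + 1 := le_antisymm hX hge
    have ht : t ∈ Set.Ioc (0 : ℝ) γ := ⟨by linarith [htm.1], by linarith [htp.2]⟩
    rcases Nat.lt_or_ge i n with hin | hin
    · -- an OLDER coupling: the second-order step inequality with the profiles `D₁`, `D₂`
      set D₁ : ℕ → ℝ := fun j => if i < j then ℓ₁ * μ₁ ^ (j - 1 - i) * d else 0 with hD₁
      set D₂ : ℕ → ℝ := fun j => if i < j then L₂ * ν ^ (j - 1 - i) * d ^ 2 else 0 with hD₂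
      have hold : ∀ (U' : Bg) (X' : C.Dom), C.scale X' ≤ n →
          |E (Function.update g i (t + d)) U' X' - E (Function.update g i t) U' X'| ≤ Real.exp (-(κ * C.d X')) * D₁ (C.scale X') ∧
          |E (Function.update g i t) U' X' - E (Function.update g i (t - d)) U' X'| ≤ Real.exp (-(κ * C.d X')) * D₁ (C.scale X') ∧
          |E (Function.update g i (t + d)) U' X' - 2 * E (Function.update g i t) U' X' + E (Function.update g i (t - d)) U' X'| ≤
            Real.exp (-(κ * C.d X')) * D₂ (C.scale X') := by
        intro U' X' hX'
        by_cases hi' : i < C.scale X'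
        · simp only [hD₁, hD₂, if_pos hi']
          refine ⟨?_, ?_, ?_⟩
          · have h := hL1 g hg U' X' i hi' (t + d) htp t ht
            rwa [show t + d - t = d by ring, abs_of_pos hd] at h
          · have h := hL1 g hg U' X' i hi' t ht (t - d) htm
            rwa [show t - (t - d) = d by ring, abs_of_pos hd] at h
          · have h := ih g hg U' X' i hX' hi' t d hd htm htp
            calc _ ≤ L₂ * ν ^ (C.scale X' - 1 - i) * Real.exp (-(κ * C.d X')) * d ^ 2 := h
              _ = Real.exp (-(κ * C.d X')) * (L₂ * ν ^ (C.scale X' - 1 - i) * d ^ 2) := by ring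
        · -- scales `≤ i`: the three histories agree below the scale, so the terms coincide (prefix dependence)
          simp only [hD₁, hD₂, if_neg hi', mul_zero]
          have hagree : ∀ s s' : ℝ, s ∈ Set.Ioc (0 : ℝ) γ → s' ∈ Set.Ioc (0 : ℝ) γ →
              E (Function.update g i s) U' X' = E (Function.update g i s') U' X' := fun s s' hs hs' =>
            hP _ (T4CouplingAnalyticity.update_mem_boxWindow hg i hs) _ (T4CouplingAnalyticity.update_mem_boxWindow hg i hs') U' X'
              fun m hm => by
                have hmi : m ≠ i := by omega
                rw [Function.update_of_ne hmi, Function.update_of_ne hmi]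
          rw [hagree (t + d) t htp ht, hagree (t - d) t htm ht]
          refine ⟨by simp, by simp, ?_⟩
          rw [show E (Function.update g i t) U' X' - 2 * E (Function.update g i t) U' X' + E (Function.update g i t) U' X' = 0 by ring]
          simp
      have hstep := hS2old g hg i t d hd htm htp D₁ D₂ n hin hold U X hk
      have harith := renewal2_sum_le (a := a) (b := b) (d := d) hin ha hb hc hcb hω hν hμν hL₂0 hL₂'
      rw [hk, show n + 1 - 1 - i = n - i by omega]
      calc _ ≤ Real.exp (-(κ * C.d X)) * ∑ j ∈ range (n + 1), (a n j * D₂ j + b n j * D₁ j ^ 2) := hstep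
        _ ≤ Real.exp (-(κ * C.d X)) * (L₂ * ν ^ (n - i) * d ^ 2) :=
            mul_le_mul_of_nonneg_left harith (Real.exp_pos _).le
        _ = L₂ * ν ^ (n - i) * Real.exp (-(κ * C.d X)) * d ^ 2 := by ring
    · -- the LAST coupling `i = n`: birth bound `lam₂ n ≤ ℓ₂ ≤ L₂`
      have hin' : i = n := by omega
      subst hin'
      have h := hS2last g hg i t d hd htm htp U X hk
      rw [hk, show i + 1 - 1 - i = 0 by omega, pow_zero, mul_one]
      calc _ ≤ Real.exp (-(κ * C.d X)) * (lam₂ i * d ^ 2) := h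
        _ ≤ Real.exp (-(κ * C.d X)) * (L₂ * d ^ 2) :=
            mul_le_mul_of_nonneg_left (mul_le_mul_of_nonneg_right ((hlam₂ i).trans (le_max_left _ _)) (sq_nonneg d))
              (Real.exp_pos _).le
        _ = L₂ * Real.exp (-(κ * C.d X)) * d ^ 2 := by ring

end Abstract


/-! ## §3 Node N22 on ROAD 2 from the second-order step recursion -/

section Knit

open Literature.MathematicalPhysics.QuantumFieldTheory.Balaban1983to89
open Literature.MathematicalPhysics.QuantumFieldTheory.Balaban1983to89.T4OutputRate
open Summit.QuantumFields.YangMills.BalabanUVNodes.N22KnitDiscrete (ne9_and_fadingMemory_of_osc_secondDiff)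

variable {C : Carriers} {Bg : Type} {E : Functional C Bg}

/-- **NODE N22 FROM (P) + (O) + THE SECOND-ORDER STEP RECURSION.**  (P) prefix dependence, (O) oscillation fading (`C₀ ≥ 0`, rate
`θ ≥ 0`; = tower-NE5), (L1) first-order moduli `ℓ₁·μ₁^{age−1}`, (S2-last), (S2-old) with channel weights `c·ω^{k−j}`, `c_b·ω^{k−j}` and
`lam₂ ≤ ℓ₂`; a growth rate `ν` with `ω + c < ν`, `μ₁² ≤ ν`, and `ρ ∈ ]0, 1]`, `τ > 0` with `θ ≤ τρ`, `νρ ≤ τ`.  Then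
**`NE9 E (Window γ) κ Λ₁ ∧ FadingMemory C₉ τ Λ₁`**, `Λ₁ k i = C₉·τ^{k−i}`, `C₉ = (4C₀∕γ + L₂γ∕2)∕τ`, `L₂ = max ℓ₂ (c_b ℓ₁²∕(ν − ω − c))` —
node N22's statement of record BY NAME; fading available iff `θν < 1`. [folklore] -/
theorem ne9_and_fadingMemory_of_osc_stepSecondDiff {γ κ C₀ θ ℓ₁ μ₁ ℓ₂ c cb ω ν ρ τ : ℝ} {a b : ℕ → ℕ → ℝ} {lam₂ : ℕ → ℝ}
    (hP : PrefixDependenceOn E (Window γ))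
    (hO : ∀ g ∈ Window γ, ∀ g' ∈ Window γ, ∀ (U : Bg) (X : C.Dom) (a : ℕ), a ≤ C.scale X →
      (∀ n, a ≤ n → g n = g' n) → |E g U X - E g' U X| ≤ C₀ * θ ^ (C.scale X - a) * Real.exp (-(κ * C.d X)))
    (hL1 : ∀ g ∈ Window γ, ∀ (U : Bg) (X : C.Dom) (i : ℕ), i < C.scale X → ∀ s ∈ Set.Ioc (0 : ℝ) γ, ∀ s' ∈ Set.Ioc (0 : ℝ) γ,
      |E (Function.update g i s) U X - E (Function.update g i s') U X| ≤
        Real.exp (-(κ * C.d X)) * (ℓ₁ * μ₁ ^ (C.scale X - 1 - i) * |s - s'|))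
    (hS2last : ∀ g ∈ Window γ, ∀ (k : ℕ) (t d : ℝ), 0 < d → t - d ∈ Set.Ioc (0 : ℝ) γ → t + d ∈ Set.Ioc (0 : ℝ) γ →
      ∀ (U : Bg) (X : C.Dom), C.scale X = k + 1 →
        |E (Function.update g k (t + d)) U X - 2 * E (Function.update g k t) U X + E (Function.update g k (t - d)) U X| ≤
          Real.exp (-(κ * C.d X)) * (lam₂ k * d ^ 2))
    (hS2old : ∀ g ∈ Window γ, ∀ (i : ℕ) (t d : ℝ), 0 < d → t - d ∈ Set.Ioc (0 : ℝ) γ → t + d ∈ Set.Ioc (0 : ℝ) γ →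
      ∀ (D₁ D₂ : ℕ → ℝ) (k : ℕ), i < k →
        (∀ (U' : Bg) (X' : C.Dom), C.scale X' ≤ k →
          |E (Function.update g i (t + d)) U' X' - E (Function.update g i t) U' X'| ≤ Real.exp (-(κ * C.d X')) * D₁ (C.scale X') ∧
          |E (Function.update g i t) U' X' - E (Function.update g i (t - d)) U' X'| ≤ Real.exp (-(κ * C.d X')) * D₁ (C.scale X') ∧
          |E (Function.update g i (t + d)) U' X' - 2 * E (Function.update g i t) U' X' + E (Function.update g i (t - d)) U' X'| ≤
            Real.exp (-(κ * C.d X')) * D₂ (C.scale X')) →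
        ∀ (U : Bg) (X : C.Dom), C.scale X = k + 1 →
          |E (Function.update g i (t + d)) U X - 2 * E (Function.update g i t) U X + E (Function.update g i (t - d)) U X| ≤
            Real.exp (-(κ * C.d X)) * ∑ j ∈ range (k + 1), (a k j * D₂ j + b k j * D₁ j ^ 2))
    (ha : ∀ k j, j ≤ k → 0 ≤ a k j ∧ a k j ≤ c * ω ^ (k - j)) (hb : ∀ k j, j ≤ k → 0 ≤ b k j ∧ b k j ≤ cb * ω ^ (k - j))
    (hlam₂ : ∀ k, lam₂ k ≤ ℓ₂) (hℓ₂ : 0 ≤ ℓ₂) (hc : 0 ≤ c) (hcb : 0 ≤ cb) (hω : 0 ≤ ω) (hν : ω + c < ν) (hμν : μ₁ ^ 2 ≤ ν)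
    (hC₀ : 0 ≤ C₀) (hθ0 : 0 ≤ θ) (hγ : 0 < γ) (hρ0 : 0 < ρ) (hρ1 : ρ ≤ 1) (hθτρ : θ ≤ τ * ρ) (hνρτ : ν * ρ ≤ τ) (hτ0 : 0 < τ) :
    NE9 E (Window γ) κ
        (fun k i => (4 * C₀ / γ + max ℓ₂ (cb * ℓ₁ ^ 2 / (ν - ω - c)) * γ / 2) / τ * τ ^ (k - i)) ∧
      FadingMemory ((4 * C₀ / γ + max ℓ₂ (cb * ℓ₁ ^ 2 / (ν - ω - c)) * γ / 2) / τ) τ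
        (fun k i => (4 * C₀ / γ + max ℓ₂ (cb * ℓ₁ ^ 2 / (ν - ω - c)) * γ / 2) / τ * τ ^ (k - i)) := by
  have hν0 : 0 ≤ ν := by nlinarith [sq_nonneg μ₁]
  have hL₂ : 0 ≤ max ℓ₂ (cb * ℓ₁ ^ 2 / (ν - ω - c)) := hℓ₂.trans (le_max_left _ _)
  have hR2 := secondDiff_of_stepSecondDiff hP hL1 hS2last hS2old ha hb hlam₂ hℓ₂ hc hcb hω hν hμν
  exact ne9_and_fadingMemory_of_osc_secondDiff (μ := ν) hP hO
    (fun g hg U X i hi t d hd h1 h2 => hR2 g hg U X i hi t d hd h1 h2) hC₀ hθ0 hL₂ hν0 hγ hρ0 hρ1 hθτρ hνρτ hτ0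

end Knit

end Summit.QuantumFields.YangMills.BalabanUVNodes.N22KnitRecursion

end
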